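import Literature.AlgebraicGeometry.Motives.CompleteIntersectionChowGroups
import HarnessLib

/-!
# `CH₂ ⊗ ℚ` of smooth cubic eightfolds has rank `≤ 1` (Hirschowitz–Iyer 2010, Thm. 1.5 at `(n, r, s, d) = (9, 2, 1, (3))`; Otwinowska 1999) — named fact

Layer `Literature/AlgebraicGeometry/Motives`. Requested by cell hodge-nonav (memo ROUTE-P1 §9 item 2,
rung R4 "HC for every smooth cubic eightfold"): with `CH₀`, `CH₁` from the typed Esnault–Levine–Viehweg
fact (`EsnaultLevineViehweg1997_chowGroup_rank_le_one`, `l = 1`: `C(4,2) = 6 ≤ 9`) and `CH₂` from THIS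
fact, Laterveer 1998 / Vial 2013 Thm. 7.1 (i) (`Vial2013_hodgeConjectureFor_of_chowGroups_rank_le_one_holds`,
`d = 8`, `l = ⌊(8-4)/2⌋ = 2`) gives the Hodge conjecture for every smooth cubic eightfold; ELV's own
bound misses `CH₂` here (`C(5,3) = 10 > 9`).

Source READ (held text `paper:arxiv-0903.5018`): A. Hirschowitz, J. N. N. Iyer, *Hilbert schemes of fat
r-planes and the triviality of Chow groups of complete intersections*, Contemp. Math. **522** (2010) 53–70.
Base field algebraically closed of characteristic `0` (§1.8); `QCH_r := CH_r ⊗ ℚ`, and (§1.1, verbatim)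
"`QCH_r(Y) := CH_r(Y) ⊗ ℚ` is trivial, namely one-dimensional (generated by the linear sections)".
* §1.5, **Proposition 1.4** (verbatim): "Let `n, r, s, d₁, …, d_s` be integers satisfying
  `r ≥ 0, s ≥ 1, n ≥ r + s, 2 ≤ d₁ ≤ ⋯ ≤ d_{s−1} < d_s` and the ("expected") inequality `ρ + r ≥ n − s`
  where `ρ := (r+2)(n−r) − Σ_{i=1}^{s} C(dᵢ + r + 1, r + 1)` is the dimension of the variety of `d_s`-fat
  `r`-planes in the general complete intersection of type `(d₁, …, d_s)` (see §4). If `Y ⊂ Y'` is any pair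
  of type `(d₁, …, d_s)` in `ℙⁿ`, then `Y` is covered by strong `r`-planes." (a pair `Y ⊂ Y'` has type
  `(d₁, …, d_s)` if `Y'` has type `(d₁, …, d_{s−1})` — a union of irreducible components of a complete
  intersection of that multidegree — and `Y` is a divisor of degree `d_s` in `Y'`; for `s = 1`, `Y' = ℙⁿ`.)
* §1.6, **Theorem 1.5** (verbatim): "Let `n, r, s, d₁ ≤ ⋯ ≤ d_{s−1} < d_s` be integers as above, satisfying
  `ρ + r > n − s` [so printed in the arXiv text at Thm. 1.5; Prop. 1.4 — "integers as above" — prints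
  `≥`; the instance below has `10 > 8`, inside either reading]. If `Y ⊂ Y'` is any pair of type
  `(d₁, …, d_s)` in `ℙⁿ`, and if `QCH_{r+1}(Y')` is trivial, then so is `QCH_r(Y)`." (By Thm. 1.3 the
  restriction map `QCH_{r+1}(Y') → QCH_r(Y)` is onto once `Y` is covered by strong `r`-planes.)
* §1.7 (verbatim): "… It was rediscovered by A. Otwinowska [Ot]: there the statement concerns all smooth
  hypersurfaces, and the geometric meaning of the bound is that the hypersurfaces of degree `d` in
  `ℙ^{n+1}` (not `ℙⁿ`!) are covered by `(r+1)`-planes. Surprisingly, our small step gives exactly the same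
  bound, with a third geometric meaning for the condition, namely that the hypersurfaces are covered by
  `d`-fat `r`-planes. Furthermore, our statement concerns all hypersurfaces, not only smooth ones."
  [Ot] = A. Otwinowska, *Remarques sur les groupes de Chow des hypersurfaces de petit degré*, C. R. Acad.
  Sci. Paris 329 (1999) 51–56 (paywalled; acq-02340 cite-only).
* Ch. Vial, *Algebraic cycles and fibrations*, Doc. Math. 18 (2013), §7.2.2 (verbatim, held
  `paper:arxiv-1203.2650` p0020): "Let `X ⊂ ℙⁿ` be a cubic hypersurface. Then `CH₀(X) = ℚ` for
  `dim X ≥ 2`. `CH₁(X) = ℚ` for `dim X ≥ 5`. `CH₂(X) = ℚ` for `dim X ≥ 8`. Note that Theorem (ELV) only gives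
  `CH₂(X) = ℚ` for `dim X ≥ 9`. The bound on the dimension of `X` was improved to `dim X = 8` by Otwinowska."

THE INSTANCE VENDORED: `(n, r, s, (d₁)) = (9, 2, 1, (3))`: `n ≥ r + s` (`9 ≥ 3`), `d_s = 3 ≥ 2` is the
unique degree, `ρ = 4·7 − C(6, 3) = 28 − 20 = 8`, `ρ + r = 10 > n − s = 8`; `Y' = ℙ⁹` with
`QCH₃(ℙ⁹) = ℚ·[ℙ³]` trivial; hence **for every cubic hypersurface `Y ⊂ ℙ⁹` over an algebraically closed
field of characteristic `0`, `QCH₂(Y)` is trivial** (`≅ ℚ`). (At `n = 8`: `ρ = 4`, `ρ + r = 6 < 7` — the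
cubic sevenfold is NOT covered, consistent with Vial's "`dim X ≥ 8`".) Rendering, exactly as narrow as the
sibling facts `EsnaultLevineViehweg1997_chowGroup_rank_le_one` and `HirschowitzIyer2010_QCH1_quadricCubic_P8`:
the tree's smooth complete intersections `IsSmoothCompleteIntersection 8 ![3] X` (smooth cubic eightfolds
with their Jacobian presentation in `ℙ⁹`; print covers all cubic hypersurfaces — narrower, never wider),
and "rank `≤ 1`" as `∀ x y, ∃ (p, q) ≠ (0, 0), p • x = q • y` (weaker than "`≅ ℚ`"). Named fact
(D-0014), not proved here: the printed proof is HI §§2–6 (strong planes, fat planes, maximal-rank) — the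
tree has this machinery only for the `(8, 1, 2, (2,3))` instance (`Motives/HirschowitzIyer*`).

## References

* [HirschowitzIyer2010] A. Hirschowitz, J. N. N. Iyer, Contemp. Math. 522 (2010) 53–70 = arXiv:0903.5018,
  Prop. 1.4, Thm. 1.5, §1.7, §1.8.
* [Otwinowska1999] A. Otwinowska, C. R. Acad. Sci. Paris Sér. I 329 (1999) 51–56.
* [Vial2013] Ch. Vial, Doc. Math. 18 (2013) 1521–1553, §7.2.2 and Thm. 7.1 (i), Prop. 7.5 (iii).
* [EsnaultLevineViehweg1997] H. Esnault, M. Levine, E. Viehweg, Duke Math. J. 87 (1997), Thm. 4.6.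
-/

noncomputable section

open CategoryTheory AlgebraicGeometry

universe u

namespace Literature.AlgebraicGeometry.Motives

/-- **Hirschowitz–Iyer 2010, Thm. 1.5 with Prop. 1.4 at `(n, r, s, d) = (9, 2, 1, (3))` (the bound of
Otwinowska 1999 for smooth hypersurfaces; Vial 2013 §7.2.2 "`CH₂(X) = ℚ` for `dim X ≥ 8`")**: for a
smooth cubic eightfold `X ⊂ ℙ⁹_k` (a smooth complete intersection of multidegree `(3)`), `k` algebraically
closed of characteristic `0`, the group `CH₂(X) ⊗ ℚ` has rank `≤ 1`: any two classes of `2`-cycles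
satisfy a non-trivial integral relation. (Print: "`QCH₂(Y)` is trivial" for EVERY cubic hypersurface
`Y ⊂ ℙ⁹`, given `QCH₃(ℙ⁹) = ℚ`; rendered narrower — smooth, Jacobian presentation — and with the weaker
rank-`≤ 1` conclusion, see the module docstring.) Named fact (D-0014); consumers take
`(h : HirschowitzIyer2010_chowTwo_rank_le_one_cubicEightfold)`.
[cite: HirschowitzIyer2010, Thm. 1.5 and Prop. 1.4 (§§1.5–1.6) at (n,r,s,d) = (9,2,1,(3)); §1.7]
[cite: Vial2013, §7.2.2] [cite: Otwinowska1999, Théorème] -/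
def HirschowitzIyer2010_chowTwo_rank_le_one_cubicEightfold : Prop :=
  ∀ ⦃k : Type u⦄ [Field k] [IsAlgClosed k] [CharZero k] ⦃X : SchemeOver k⦄,
    IsSmoothCompleteIntersection 8 ![3] X →
      ∀ x y : ChowGroup X.left 2, ∃ p q : ℤ, (p ≠ 0 ∨ q ≠ 0) ∧ p • x = q • y

/-- **All three small Chow groups of a smooth cubic eightfold** (the shape memo ROUTE-P1 feeds to
Vial/Laterveer): granted the fact, and the typed ELV fact for `CH₀`, `CH₁` (`l = 1`: `3 ≥ 3` and
`C(1+3, 2) = 6 ≤ 8 + 1`), `CH_i(X) ⊗ ℚ` has rank `≤ 1` for every `i ≤ 2`.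
[cite: Vial2013, §7.2.2] [cite: EsnaultLevineViehweg1997, Thm 4.6, first bullet] -/
theorem chowGroup_rank_le_one_of_le_two_cubicEightfold
    (h : HirschowitzIyer2010_chowTwo_rank_le_one_cubicEightfold.{u})
    (hR : EsnaultLevineViehweg1997_chowGroup_rank_le_one.{u})
    {k : Type u} [Field k] [IsAlgClosed k] [CharZero k] {X : SchemeOver k}
    (hX : IsSmoothCompleteIntersection 8 ![3] X) {i : ℕ} (hi : i ≤ 2)
    (x y : ChowGroup X.left i) : ∃ p q : ℤ, (p ≠ 0 ∨ q ≠ 0) ∧ p • x = q • y := by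
  rcases Nat.lt_or_ge i 2 with hlt | hge
  · exact hR hX (fun a ↦ by fin_cases a; simp) (l := 1) (Or.inl ⟨0, by simp⟩)
      (by simp [Nat.choose]) (Nat.lt_succ_iff.mp hlt) x y
  · obtain rfl : i = 2 := le_antisymm hi hge
    exact h hX x y

/-- **The fact is a special case of "all Chow groups of smooth complete intersections below the
middle are `ℚ`-lines"** only in the direction fact ⇒ instance; recorded upper bound: it follows from the
generalized Bloch conjecture for cubic hypersurfaces (Voisin's Conjecture 6.3 with `c = 3`, `n = 9 ≥ 3·3`),
nothing stronger is claimed. Sanity unfolding. [cite: HirschowitzIyer2010, Thm. 1.5] -/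
theorem HirschowitzIyer2010_chowTwo_rank_le_one_cubicEightfold.apply
    (h : HirschowitzIyer2010_chowTwo_rank_le_one_cubicEightfold.{u})
    {k : Type u} [Field k] [IsAlgClosed k] [CharZero k] {X : SchemeOver k}
    (hX : IsSmoothCompleteIntersection 8 ![3] X) (x y : ChowGroup X.left 2) :
    ∃ p q : ℤ, (p ≠ 0 ∨ q ≠ 0) ∧ p • x = q • y :=
  h hX x y

end Literature.AlgebraicGeometry.Motives

end
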